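import Summits.NavierStokesRegularity.NavierStokesRegularity.Theses.PumpContinuation
import Summits.NavierStokesRegularity.NavierStokesRegularity.Theorems.AveragedTypeIBlowup.Negative.SymmetryRedundant
import Literature.Analysis.FluidPDE.TaoAveragedSobolevProofs

/-!
# Crux `BoundedTemperatureClosed` (stmt-NavierStokesRegularity-18303), negative side:
# the symmetry hypothesis is decoration; the Euler-datum instance is trivially closed

Negative-side support lemmas (refuter, birth vetting of route PumpContinuation; extracted from
`Cruxes/BoundedTemperatureClosed/Disproof.lean`). Nothing here closes the item (`--supports`); no
statement of the route is changed; no conclusion asserts a Theses decl positively.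

* `boundedTemperatureClosed_iff_noSymm` — hypothesis-mutation finding: the crux is EQUIVALENT to its
  version with `𝒜.IsSymmetric` dropped. The mild formulation (Tao 2016, (1.15)) only evaluates the
  diagonal `T(u,u)`; the symmetrisation `𝒜.symmetrize` (accepted, `TaoAveragedSobolevSymmetry.lean`)
  is symmetric, keeps (1.16), and has the same diagonal form (the landed
  `AveragedTypeIBlowup.Negative.symmetrize_form_diag`), hence the same segment forms on the diagonal
  and the same bounded-temperature blow-up sets (`btSet_symmetrize_eq`). Provers may assume symmetry
  for free; disprovers gain nothing from non-symmetric data.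
* `euler_instance_isClosed` — degenerate-instance probe: for the Euler datum (`mᵢ ≡ 1`; symmetric and
  cancelling) the segment `T_θ = (1-θ)B + θB = B` is constant in `θ` (`segForm_euler_eq`), so the
  bounded-temperature blow-up set is `∅` or `[0,1]` and the crux holds there with no analysis
  (`isClosed_sep_const`). (For the scaled-Euler / zero data the crux instead encodes attainment of the
  infimal Type-I constant of Schwartz-data mild Navier–Stokes blow-ups — see the item's ATTACK.md.)

## References

* T. Tao, J. Amer. Math. Soc. 29 (2016), arXiv:1402.0290v3, §1.1 (1.13), (1.15), (1.16), Remark 1.6.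
  [`Tao2016AveragedNS`]
-/

noncomputable section

-- the nested summit namespace `…NavierStokesRegularity.NavierStokesRegularity…` is the tree's layout
-- (D-0017), so the duplicated-namespace linter must be silenced for every declaration below
set_option linter.dupNamespace false

namespace Summit.NavierStokesRegularity.NavierStokesRegularity.Theorems.BoundedTemperatureClosed.Negative

open MeasureTheory Set Filter Topology
open scoped ENNReal
open Literature.Analysis.FluidPDE Literature.Analysis.FluidPDE.Tao2016
open Summit.NavierStokesRegularity.NavierStokesRegularity.Theses.PumpContinuation
open Summit.NavierStokesRegularity.NavierStokesRegularity.Theorems.AveragedTypeIBlowup.Negative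
  (symmetrize_form_diag)

/-- The bounded-temperature blow-up set of the datum `𝒜` at ceiling `M` along the segment
`T_θ = (1-θ)·B̃_𝒜 + θ·B` — verbatim the set whose closedness the crux asserts (a notation, so that the
statements below are syntactically instances of the crux body). -/
local notation3 "btSet[" 𝒜 ", " M "]" =>
  {θ : ℝ | θ ∈ Set.Icc (0 : ℝ) 1 ∧
    ∃ u₀ : SchwartzMap (EuclideanSpace ℝ (Fin 3)) (EuclideanSpace ℝ (Fin 3)),
      Literature.Analysis.FluidPDE.VectorCalculus.IsDivFree ⇑u₀ ∧ ∃ S : ℝ, 0 < S ∧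
      ∃ u : ℝ → Literature.Analysis.FluidPDE.Tao2016.L2C,
        Literature.Analysis.FluidPDE.Tao2016.IsMildSolutionFor
          (fun a b c => ((1 - θ : ℝ) : ℂ) * AveragingDatum.form 𝒜 a b c +
            ((θ : ℝ) : ℂ) * Literature.Analysis.FluidPDE.Tao2016.eulerForm a b c)
          (Literature.Analysis.FluidPDE.Tao2016.schwartzL2 u₀) (Set.Ico 0 S) u ∧
        (∀ t ∈ Set.Ico 0 S, MeasureTheory.eLpNorm (u t) ⊤ MeasureTheory.volume ≤
          ENNReal.ofReal (M / Real.sqrt (S - t))) ∧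
        ¬ ∃ S' : ℝ, S < S' ∧ ∃ v : ℝ → Literature.Analysis.FluidPDE.Tao2016.L2C,
          Literature.Analysis.FluidPDE.Tao2016.IsMildSolutionFor
            (fun a b c => ((1 - θ : ℝ) : ℂ) * AveragingDatum.form 𝒜 a b c +
              ((θ : ℝ) : ℂ) * Literature.Analysis.FluidPDE.Tao2016.eulerForm a b c)
            (Literature.Analysis.FluidPDE.Tao2016.schwartzL2 u₀) (Set.Ico 0 S') v ∧
          ∀ t ∈ Set.Ico 0 S, v t = u t}

/-- The crux, read through the notation (definitional unfolding). [folklore] -/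
theorem boundedTemperatureClosed_iff :
    BoundedTemperatureClosed ↔
      ∀ 𝒜 : AveragingDatum, 𝒜.IsSymmetric → 𝒜.HasCancellation → ∀ M : ℝ, IsClosed btSet[𝒜, M] :=
  Iff.rfl

/-! ### `IsSymmetric` is decoration -/

/-- Mild solutions only see the diagonal `T(u,u)`: two trilinear forms that agree on the diagonal of
the first two slots have the same mild solutions. [folklore] -/
theorem isMildSolutionFor_congr_diag {T T' : L2C → L2C → L2C → ℂ} (h : ∀ a c, T a a c = T' a a c)
    {u₀ : L2C} {I : Set ℝ} {u : ℝ → L2C} :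
    IsMildSolutionFor T u₀ I u ↔ IsMildSolutionFor T' u₀ I u := by
  unfold IsMildSolutionFor
  simp only [h]

/-- The segment forms of `𝒜.symmetrize` and of `𝒜` agree on the diagonal. [folklore] -/
theorem segForm_symmetrize_diag (𝒜 : AveragingDatum) (θ : ℝ) (a c : L2C) :
    ((1 - θ : ℝ) : ℂ) * 𝒜.symmetrize.form a a c + ((θ : ℝ) : ℂ) * eulerForm a a c =
      ((1 - θ : ℝ) : ℂ) * 𝒜.form a a c + ((θ : ℝ) : ℂ) * eulerForm a a c := by
  rw [symmetrize_form_diag]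

/-- Hence `𝒜.symmetrize` and `𝒜` have the same bounded-temperature blow-up sets. [folklore] -/
theorem btSet_symmetrize_eq (𝒜 : AveragingDatum) (M : ℝ) :
    btSet[𝒜.symmetrize, M] = btSet[𝒜, M] := by
  ext θ
  simp only [mem_setOf_eq,
    isMildSolutionFor_congr_diag
      (T := fun a b c => ((1 - θ : ℝ) : ℂ) * 𝒜.symmetrize.form a b c + ((θ : ℝ) : ℂ) * eulerForm a b c)
      (T' := fun a b c => ((1 - θ : ℝ) : ℂ) * 𝒜.form a b c + ((θ : ℝ) : ℂ) * eulerForm a b c)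
      (segForm_symmetrize_diag 𝒜 θ)]

/-- **`IsSymmetric` is decoration in `BoundedTemperatureClosed`** (hypothesis-mutation finding,
proved): the crux is equivalent to its version over ALL averaging data with cancellation. Given a
cancelling datum, apply the crux to its symmetrisation (symmetric, `symmetrize_isSymmetric`;
cancelling iff, `symmetrize_hasCancellation_iff`) and transport along `btSet_symmetrize_eq`. [folklore] -/
theorem boundedTemperatureClosed_iff_noSymm :
    BoundedTemperatureClosed ↔
      ∀ 𝒜 : AveragingDatum, 𝒜.HasCancellation → ∀ M : ℝ, IsClosed btSet[𝒜, M] := by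
  constructor
  · intro h 𝒜 hc M
    rw [← btSet_symmetrize_eq]
    exact h 𝒜.symmetrize 𝒜.symmetrize_isSymmetric (𝒜.symmetrize_hasCancellation_iff.2 hc) M
  · intro h 𝒜 _ hc M
    exact h 𝒜 hc M

/-! ### The Euler-datum instance is trivially closed -/

/-- A `θ`-independent condition cuts `[0,1]` down to `∅` or `[0,1]`: closed either way. [folklore] -/
theorem isClosed_sep_const (p : Prop) : IsClosed {θ : ℝ | θ ∈ Icc (0 : ℝ) 1 ∧ p} := by
  by_cases hp : p
  · simp only [hp, and_true, setOf_mem_eq]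
    exact isClosed_Icc
  · simp only [hp, and_false, setOf_false]
    exact isClosed_empty

/-- For the Euler datum the segment is constant: `T_θ = (1-θ)B + θB = B`. [folklore] -/
theorem segForm_euler_eq (θ : ℝ) :
    (fun a b c => ((1 - θ : ℝ) : ℂ) * AveragingDatum.euler.form a b c + ((θ : ℝ) : ℂ) * eulerForm a b c) =
      eulerForm := by
  funext a b c
  simp only [AveragingDatum.euler_form]
  push_cast
  ring

/-- **Degenerate instance.** At the Euler datum (symmetric and cancelling: `euler_isSymmetric`,
`euler_hasCancellation`) the crux's closedness holds unconditionally, using neither hypothesis nor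
any PDE: the set is `∅` or `[0,1]` according as Navier–Stokes has a Schwartz-data `H¹⁰_df`-mild
Type-I blow-up of constant `≤ M` with no mild extension, or not. [folklore] -/
theorem euler_instance_isClosed (M : ℝ) : IsClosed btSet[AveragingDatum.euler, M] := by
  simp only [segForm_euler_eq]
  exact isClosed_sep_const _

end Summit.NavierStokesRegularity.NavierStokesRegularity.Theorems.BoundedTemperatureClosed.Negative

end
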